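import Mathlib.Algebra.Ring.Action.Submonoid
import Mathlib.GroupTheory.Index
import Mathlib.Algebra.Ring.NegOnePow
import Literature.NumberTheory.EllipticCurves.IwasawaSelmerProofs
import Literature.NumberTheory.GaloisRepresentations.ContinuousH1
import HarnessLib

/-!
# Kobayashi's plus/minus Selmer groups: `E^±(F_{n,𝔭})`, `Sel^±(E/F_n)`, `Sel^±(E/F_∞)` and the dual
# `X^±(E/F_∞)` (definitions)

Topic `Literature/NumberTheory/EllipticCurves`, cluster `Kobayashi2003` (namespace = path). A
DEFINITION file transcribing S. Kobayashi, *Iwasawa theory for elliptic curves at supersingular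
primes*, Invent. Math. 152 (2003) 1–36 [Kobayashi2003], **Definition 1.1** (the even/odd = plus/minus
subgroups of local points, the plus/minus Selmer groups over the layers of the cyclotomic
`ℤ_p`-extension, their direct limit) together with the Pontryagin-dual hypothesis structure carrying
the `λ^±/μ^±`-invariants and the characteristic ideal of Thm. 1.2/1.4 and of the main conjecture.
HONEST FRAMING (BSD rank-`≤ 1` residual cell `b2b-bsdres`, harvest seat 2, gen 11; the "(V-±)
vocabulary" asked for by the supersingular sub-cell, `HOME/b2b-bsdres-x10b/X6-ROUTE.md` §2 (i), so that
the SHAPE `SignedDatum` of `Summits/…/Rank1Residual/Supersingular/SignedRankZero.lean` can be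
re-targeted to real objects): VOCABULARY ONLY — definitions with bodies, proved unfolding /
comparison lemmas, ONE hypothesis structure (field for field the tree's
`WeierstrassCurve.SelmerDualData`, file `IwasawaSelmer`); NOTHING is asserted — Kobayashi's Thm. 1.2
(`X^±` finitely generated `Λ`-torsion), Thm. 1.3 (Kato divisibility) and the main conjecture are NOT
stated here, no named fact is introduced, no label of the cell moves. This is not "finishing BSD".
Pollack's `L_p^±` (the analytic side) is already in the tree: `PlusMinusPAdicLFunction.lean`
(`pollack_exists_plusMinusPAdicLFunction`).

## Source, verbatim (held copy `paper:doi-10-1007-s00222-002-0265-4`, pp. 1–2, 4)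

p. 1: "Let `p` be an odd prime. Let `F = ℚ` and `F_∞/F` the cyclotomic `ℤ_p`-extension with `n`-th
layer `F_n`." p. 2: "let `E` be an elliptic curve over `ℚ` with good supersingular reduction at `p`.
Suppose `a_p = 0`. … **Definition 1.1.** We define the `n`-th even (odd) Selmer group by
`Sel^±(E/F_n) := Ker( Sel(E/F_n) → H¹(F_{n,p}, E[p^∞]) / E^±(F_{n,p}) ⊗ ℚ_p/ℤ_p )`
where `F_{n,p}` is the completion of `F_n` at the place over `p` and
`E^+(F_{n,p}) := {P ∈ E(F_{n,p}) | Tr_{n/m+1} P ∈ E(F_{m,p}) for even m (0 ≤ m < n)}`,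
`E^-(F_{n,p}) := {P ∈ E(F_{n,p}) | Tr_{n/m+1} P ∈ E(F_{m,p}) for odd m (0 ≤ m < n)}`,
where `Tr_{n/m+1} : E(F_{n,p}) → E(F_{m+1,p})` is the trace map. … Let
`Sel^±(E/F_∞) := lim→_n Sel^±(E/F_n)`. Then `ℤ_p[[Γ]]` acts naturally on the Pontryagin dual of
`Sel^±(E/F_∞)`. **Theorem 1.2.** The Pontryagin dual of the even (odd) Selmer group `Sel^±(E/F_∞)^∨`
is a finitely generated torsion `ℤ_p[[Γ]]`-module." p. 4 (§2): "We regard `E(K_{n,v}) ⊗ ℚ_p/ℤ_p` as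
a subgroup of `H¹(K_{n,v}, E[p^∞])` by the Kummer map." (§2, Def. 2.1, is the variant over
`K_n = ℚ(ζ_{p^{n+1}})`, with the signed condition at every place and `-1 ≤ m < n` for `E^-`; it is
NOT transcribed here: TODO(general form).)

## Transcription

Written for the tree's general data — a number field `K`, `κ : ZpExtension K p` (layers
`K_n = K̄^{κ⁻¹(pⁿℤ_p)}`, `ZpExtension.layerSubgroup`), `W/K`, a `K`-field `E` (a completion `K_v`) and
a `K`-embedding `ι : K̄ → K̄_E` (a place of `K_∞` above `v`; default `closureEmb E`, as in
`SubgroupSelmer.lean`) — and specialising to Kobayashi's `K = F = ℚ`, `κ` cyclotomic, `E = ℚ_p`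
(ONE place of `F_n` above `p`, `F_{n,p} = F_n · ℚ_p`). Signs are `ε : ℤˣ` (`1` = plus/even, `-1` =
minus/odd) and "`(-1)^m`" is Mathlib's `Int.negOnePow m`.

* `localLayerSubgroupOfEmb κ ι n = Gal(K̄_E/K_n·E)` (finite index dividing `pⁿ`, decreasing in `n`);
  `localLayerPointsOfEmb W κ ι n = E(K_n·E) = E(K̄_E)^{Gal(K̄_E/K_n·E)}` (Mathlib
  `FixedPoints.addSubgroup`) — Kobayashi's `E(F_{n,p})`.
* `localTraceOfEmb W κ ι m n = Tr_{n/m} : E(K̄_E) →+ E(K̄_E)`, `P ↦ ∑_q q̃•P` over representatives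
  (`Quotient.out`) of `Gal(K̄_E/K_m·E)/Gal(K̄_E/K_n·E)`; on `E(K_n·E)` it is the trace map of the
  source, independent of the representatives (`localTraceOfEmb_apply_eq_sum_of_mem`) and valued in
  `E(K_m·E)` (`localTraceOfEmb_mem_of_mem`); elsewhere a documented junk value.
* `signedLocalPointsOfEmb W κ ι ε n = E^ε(K_n·E) = {P ∈ E(K_n·E) | ∀ m < n, (-1)^m = ε →
  Tr_{n/m+1} P ∈ E(K_m·E)}` — Definition 1.1 verbatim (`mem_signedLocalPointsOfEmb_one_iff` /
  `…_neg_one_iff` display the "even `m`" / "odd `m`" forms).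
* `localKummerOverOfEmb W p H ι A ≤ H¹(H, E[p^∞])` (`H ≤ Γ_K` with fixed field `L`, `A ≤ E(K̄_E)`
  meant inside `E(L_w)`): **the classes whose restriction to `Gal(K̄_E/L_w)` lies in the image of
  `A ⊗ ℚ_p/ℤ_p` under the Kummer map**, on explicit continuous cocycles
  (`Literature.NumberTheory.GaloisRepresentations.contOneCocycles`/`oneCocycleClass`, surjective onto
  `H¹`): `c = [φ]` with `ι(φ(τ|_{K̄})) = τQ - Q` on `Gal(K̄_E/L_w)` for some `Q ∈ E(K̄_E)` with a
  `p`-power multiple `pᵏQ ∈ A` — the Kummer cocycle of `pᵏQ ⊗ p⁻ᵏ` (every element of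
  `A ⊗ ℚ_p/ℤ_p` is such an elementary tensor; changing `φ` by a coboundary `δR`, `R ∈ E[p^∞]`,
  replaces `Q` by `Q + ιR`, which keeps a `p`-power multiple in `A`; so this is
  "`res_w c ∈ κ_w(A ⊗ ℚ_p/ℤ_p)`" exactly). It refines the tree's classical local kernel
  `localKerOverOfEmb = ker(H¹(H, E[p^∞]) → H¹(Gal(K̄_E/L_w), E(K̄_E)))` — PROVED
  (`localKummerOverOfEmb_le_localKerOverOfEmb`).
* `signedSelmerLayer W κ ε n = Sel^ε(E/K_n)`: the classical `Sel_{p^∞}(E/K_n)` (`selmerLayer`) cut by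
  the Kummer condition for `A = E^ε(K_n·K_v)` at every place `v ∣ p` of `K` and every conjugate
  (= every place of `K_n` above `v`, exactly as `selmerGroupOver` imposes local conditions) — for
  `K = ℚ`, `κ` cyclotomic: Definition 1.1 verbatim; `signedSelmerInfty W κ ε = Sel^ε(E/K_∞) :=
  lim→_n Sel^ε(E/K_n)`, the union (`⨆`) of the images under `H¹(K_n, E[p^∞]) → H¹(K_∞, E[p^∞])`
  (`layerToInfty`) inside `H¹(K_∞, E[p^∞]) = lim→ H¹(K_n, E[p^∞])`. PROVED: `Sel^ε(E/K_n) ≤ Sel(E/K_n)`,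
  `Sel^ε(E/K_∞) ≤ Sel(E/K_∞)`, and stability under the conjugation action of `Γ_K`
  (`conjH1_mem_signedSelmerLayer`, `conjH1_mem_signedSelmerInfty` — the action through which
  "`ℤ_p[[Γ]]` acts naturally on the Pontryagin dual").
* `SignedSelmerDualData W κ γ ε`: `X^ε(E/K_∞) = Hom(Sel^ε(E/K_∞), ℚ_p/ℤ_p)` with its `Λ = ℤ_p⟦T⟧`
  structure (`T = γ - 1`) as a HYPOTHESIS STRUCTURE, field for field `WeierstrassCurve.SelmerDualData`
  with `selmerInfty ↦ signedSelmerInfty` (the field `conj_mem` is now dischargeable by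
  `conjH1_mem_signedSelmerInfty`); `charIdeal`, `mu`, `lambda` as there (torsion / finite generation
  are Mathlib's `Module.IsTorsion (IwasawaAlgebra p) D.X` / `Module.Finite (IwasawaAlgebra p) D.X`,
  to be taken as hypotheses — Thm. 1.2 is not vendored here). A characteristic power series `ξ^ε` of
  `X^ε(E/ℚ_∞)` is any generator of `D.charIdeal`.

## Design notes

* The definitions make sense for every `W`, `p`, `κ`, `E`; Kobayashi's standing hypotheses (`p` odd,
  good reduction at `p`, `a_p = 0`) are hypotheses of the THEOREMS (1.2, 1.3, 9.3, B. D. Kim 2013),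
  which are not in this file.
* The signed local condition is phrased on cocycles because it is invisible in `H¹(L_w, E(K̄_E))`
  (every Kummer class dies there).
* Every declaration cites Definition 1.1 (or Thm. 1.2/1.4 for the dual's invariants), of which it is
  the transcription or unfolding API; `[folklore]` only on the two finiteness instances.
* Not here: Thm. 1.2/2.2, 1.3/4.1, 9.3, Prop. 8.12 (`E^+ ∩ E^-`), B. D. Kim's Euler characteristic,
  the `ℚ(ζ_{p^{n+1}})`-tower variant; the identification of the Kummer condition for `A = E(L_w)`
  with the classical kernel (Kummer exactness) is not needed for the definitions.
-/

noncomputable section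

open scoped Classical

open NumberField IsDedekindDomain

universe u

namespace Literature.NumberTheory.EllipticCurves.Kobayashi2003

open Literature.NumberTheory.EllipticCurves Literature.NumberTheory.GaloisRepresentations ZpExtension

section Local

variable {K : Type u} [Field K] {p : ℕ} [Fact p.Prime] (κ : ZpExtension K p)
variable {E : Type u} [Field E] [Algebra K E] (ι : AlgebraicClosure K →ₐ[K] AlgebraicClosure E)

/-! ### The local layer subgroups `Gal(K̄_E / K_n·E)` -/

/-- `Gal(K̄_E / K_n·E) ≤ Γ_E`: the local subgroup (preimage under the restriction `Γ_E → Γ_K`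
attached to `ι`) of the layer subgroup `κ⁻¹(pⁿℤ_p) = Gal(K̄/K_n)`; its fixed field in `K̄_E` is the
compositum `K_n · E`, for `E = K_v` the completion of `K_n` at the place above `v` singled out by `ι`
(Kobayashi's `F_{n,p}` for `K = ℚ`, `E = ℚ_p`). [cite: Kobayashi2003, Def. 1.1] -/
abbrev localLayerSubgroupOfEmb (n : ℕ) : Subgroup (Field.absoluteGaloisGroup E) :=
  localSubgroupOfEmb (κ.layerSubgroup n) ι

/-- Membership: `τ ∈ Gal(K̄_E/K_n·E) ↔ pⁿ ∣ κ(τ|_{K̄})`. (API of the transcription of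
Def. 1.1.) [cite: Kobayashi2003, Def. 1.1] -/
theorem mem_localLayerSubgroupOfEmb_iff (n : ℕ) (τ : Field.absoluteGaloisGroup E) :
    τ ∈ localLayerSubgroupOfEmb κ ι n ↔ (p : ℤ_[p]) ^ n ∣ (κ (resGalOfEmb ι τ)).toAdd := by
  rw [localLayerSubgroupOfEmb, mem_localSubgroupOfEmb_iff, mem_layerSubgroup]

/-- The local layer subgroups decrease: `Gal(K̄_E/K_n·E) ≤ Gal(K̄_E/K_m·E)` for `m ≤ n`. (API of the transcription of
Def. 1.1.) [cite: Kobayashi2003, Def. 1.1] -/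
theorem localLayerSubgroupOfEmb_antitone : Antitone (localLayerSubgroupOfEmb κ ι) :=
  fun _ _ h => Subgroup.comap_mono (κ.layerSubgroup_antitone h)

/-- `Gal(K̄_E/K_0·E) = Γ_E` (`K_0 = K`). (API of the transcription of
Def. 1.1.) [cite: Kobayashi2003, Def. 1.1] -/
@[simp] theorem localLayerSubgroupOfEmb_zero : localLayerSubgroupOfEmb κ ι 0 = ⊤ := by
  rw [localLayerSubgroupOfEmb, localSubgroupOfEmb, layerSubgroup_zero, Subgroup.comap_top]

/-- `Gal(K̄_E/K_n·E)` has finite index in `Γ_E`, dividing `pⁿ = [Γ_K : Gal(K̄/K_n)]`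
(`index_layerSubgroup`; the layer subgroup is normal). (API of the transcription of
Def. 1.1.) [cite: Kobayashi2003, Def. 1.1] -/
theorem index_localLayerSubgroupOfEmb_dvd (n : ℕ) :
    (localLayerSubgroupOfEmb κ ι n).index ∣ p ^ n := by
  rw [localLayerSubgroupOfEmb, localSubgroupOfEmb, Subgroup.index_comap, ← κ.index_layerSubgroup n]
  exact Subgroup.relIndex_dvd_index_of_normal _ _

/-- `Gal(K̄_E/K_n·E)` has finite index in `Γ_E`. [folklore] -/
instance finiteIndex_localLayerSubgroupOfEmb (n : ℕ) :
    (localLayerSubgroupOfEmb κ ι n).FiniteIndex := by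
  refine ⟨fun h => ?_⟩
  have hd := index_localLayerSubgroupOfEmb_dvd κ ι n
  rw [h, zero_dvd_iff] at hd
  exact (pow_ne_zero n (Fact.out : p.Prime).ne_zero) hd

/-- The relative quotient `Gal(K̄_E/K_m·E) / Gal(K̄_E/K_n·E)` (a copy of `Gal(K_n·E / K_m·E)` when
`m ≤ n`) is finite. [folklore] -/
instance finite_localLayerQuotient (m n : ℕ) :
    Finite (localLayerSubgroupOfEmb κ ι m ⧸
      (localLayerSubgroupOfEmb κ ι n).subgroupOf (localLayerSubgroupOfEmb κ ι m)) :=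
  Subgroup.finite_quotient_of_finiteIndex

/-! ### Points over the local layers and the trace maps -/

variable (W : WeierstrassCurve K)

/-- **`E(K_n·E)`**: the points of `W` over `K̄_E` fixed by `Gal(K̄_E/K_n·E)`; for `K = ℚ`, `κ`
cyclotomic, `E = ℚ_p` this is Kobayashi's `E(F_{n,p})`, `F_{n,p}` the completion of `F_n` at the
place over `p`. [cite: Kobayashi2003, Def. 1.1] -/
def localLayerPointsOfEmb (n : ℕ) : AddSubgroup (localPoints W E) :=
  FixedPoints.addSubgroup (localLayerSubgroupOfEmb κ ι n) (localPoints W E)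

/-- Membership in `E(K_n·E)`: fixed by every `τ ∈ Gal(K̄_E/K_n·E)`. (API of the transcription of
Def. 1.1.) [cite: Kobayashi2003, Def. 1.1] -/
theorem mem_localLayerPointsOfEmb_iff (n : ℕ) (P : localPoints W E) :
    P ∈ localLayerPointsOfEmb κ ι W n ↔
      ∀ τ : Field.absoluteGaloisGroup E, τ ∈ localLayerSubgroupOfEmb κ ι n → τ • P = P := by
  rw [localLayerPointsOfEmb, FixedPoints.mem_addSubgroup, Subtype.forall]
  rfl

/-- The tower `E(K_m·E) ≤ E(K_n·E)` for `m ≤ n`. (API of the transcription of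
Def. 1.1.) [cite: Kobayashi2003, Def. 1.1] -/
theorem localLayerPointsOfEmb_mono : Monotone (localLayerPointsOfEmb κ ι W) := by
  intro m n h P hP
  rw [mem_localLayerPointsOfEmb_iff] at hP ⊢
  exact fun τ hτ => hP τ (localLayerSubgroupOfEmb_antitone κ ι h hτ)

/-- `E(K_0·E) = E(E)`: the points fixed by all of `Γ_E`. (API of the transcription of
Def. 1.1.) [cite: Kobayashi2003, Def. 1.1] -/
theorem mem_localLayerPointsOfEmb_zero_iff (P : localPoints W E) :
    P ∈ localLayerPointsOfEmb κ ι W 0 ↔ ∀ τ : Field.absoluteGaloisGroup E, τ • P = P := by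
  simp [mem_localLayerPointsOfEmb_iff]

/-- **The trace `Tr_{n/m}`** as an endomorphism of `E(K̄_E)`: `P ↦ ∑_q q̃ • P`, the sum over the
(finite) quotient `Gal(K̄_E/K_m·E) / Gal(K̄_E/K_n·E)` of chosen representatives `q̃ = q.out`. On
`P ∈ E(K_n·E)` and for `m ≤ n` this is the trace `Tr_{n/m} P = ∑_{σ ∈ Gal(K_n·E/K_m·E)} σP ∈ E(K_m·E)`
of the source ("`Tr_{n/m+1} : E(F_{n,p}) → E(F_{m+1,p})` is the trace map"), independent of the
representatives; elsewhere it is a junk value. [cite: Kobayashi2003, Def. 1.1] -/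
def localTraceOfEmb (m n : ℕ) : localPoints W E →+ localPoints W E :=
  haveI := Fintype.ofFinite (localLayerSubgroupOfEmb κ ι m ⧸
    (localLayerSubgroupOfEmb κ ι n).subgroupOf (localLayerSubgroupOfEmb κ ι m))
  ∑ q : localLayerSubgroupOfEmb κ ι m ⧸
      (localLayerSubgroupOfEmb κ ι n).subgroupOf (localLayerSubgroupOfEmb κ ι m),
    DistribSMul.toAddMonoidHom (localPoints W E) ((q.out : localLayerSubgroupOfEmb κ ι m) :
      Field.absoluteGaloisGroup E)

/-- Unfolding the trace: `Tr_{n/m} P = ∑_q q.out • P` (any `Fintype` instance on the quotient).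
(API of the transcription of
Def. 1.1.) [cite: Kobayashi2003, Def. 1.1] -/
theorem localTraceOfEmb_apply (m n : ℕ)
    [Fintype (localLayerSubgroupOfEmb κ ι m ⧸
      (localLayerSubgroupOfEmb κ ι n).subgroupOf (localLayerSubgroupOfEmb κ ι m))]
    (P : localPoints W E) :
    localTraceOfEmb κ ι W m n P =
      ∑ q : localLayerSubgroupOfEmb κ ι m ⧸
          (localLayerSubgroupOfEmb κ ι n).subgroupOf (localLayerSubgroupOfEmb κ ι m),
        ((q.out : localLayerSubgroupOfEmb κ ι m) : Field.absoluteGaloisGroup E) • P := by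
  rw [localTraceOfEmb, AddMonoidHom.finsetSum_apply]
  exact Finset.sum_congr (by convert rfl) fun q _ => rfl

/-- For `P ∈ E(K_n·E)` the summand `q.out • P` only depends on the coset `q`: any representative
`σ` of `q` gives `σ • P`. (API of the transcription of
Def. 1.1.) [cite: Kobayashi2003, Def. 1.1] -/
theorem out_smul_eq_of_mem {m n : ℕ} {P : localPoints W E} (hP : P ∈ localLayerPointsOfEmb κ ι W n)
    (σ : localLayerSubgroupOfEmb κ ι m) :
    ((QuotientGroup.mk (s := (localLayerSubgroupOfEmb κ ι n).subgroupOf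
        (localLayerSubgroupOfEmb κ ι m)) σ).out : Field.absoluteGaloisGroup E) • P =
      (σ : Field.absoluteGaloisGroup E) • P := by
  obtain ⟨h, hh⟩ := QuotientGroup.mk_out_eq_mul
    ((localLayerSubgroupOfEmb κ ι n).subgroupOf (localLayerSubgroupOfEmb κ ι m)) σ
  rw [hh, Subgroup.coe_mul, mul_smul]
  congr 1
  exact (mem_localLayerPointsOfEmb_iff κ ι W n P).mp hP _ (Subgroup.mem_subgroupOf.mp h.2)

/-- **Independence of representatives.** For `P ∈ E(K_n·E)` and ANY section `s` of
`Gal(K̄_E/K_m·E) → Gal(K̄_E/K_m·E)/Gal(K̄_E/K_n·E)`, `Tr_{n/m} P = ∑_q s(q) • P`. (API of the transcription of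
Def. 1.1.) [cite: Kobayashi2003, Def. 1.1] -/
theorem localTraceOfEmb_apply_eq_sum_of_mem (m n : ℕ)
    [Fintype (localLayerSubgroupOfEmb κ ι m ⧸
      (localLayerSubgroupOfEmb κ ι n).subgroupOf (localLayerSubgroupOfEmb κ ι m))]
    {P : localPoints W E} (hP : P ∈ localLayerPointsOfEmb κ ι W n)
    (s : localLayerSubgroupOfEmb κ ι m ⧸
        (localLayerSubgroupOfEmb κ ι n).subgroupOf (localLayerSubgroupOfEmb κ ι m) →
      localLayerSubgroupOfEmb κ ι m)
    (hs : ∀ q, (QuotientGroup.mk (s q) : _ ⧸ _) = q) :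
    localTraceOfEmb κ ι W m n P = ∑ q, ((s q : localLayerSubgroupOfEmb κ ι m) :
      Field.absoluteGaloisGroup E) • P := by
  rw [localTraceOfEmb_apply]
  refine Finset.sum_congr rfl fun q _ => ?_
  conv_lhs => rw [← hs q]
  exact out_smul_eq_of_mem κ ι W hP (s q)

/-- `Tr_{n/m} P ∈ E(K_m·E)` for `P ∈ E(K_n·E)`: left multiplication by `τ ∈ Gal(K̄_E/K_m·E)` permutes
the cosets. (API of the transcription of
Def. 1.1.) [cite: Kobayashi2003, Def. 1.1] -/
theorem localTraceOfEmb_mem_of_mem (m n : ℕ) {P : localPoints W E}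
    (hP : P ∈ localLayerPointsOfEmb κ ι W n) :
    localTraceOfEmb κ ι W m n P ∈ localLayerPointsOfEmb κ ι W m := by
  classical
  set N := (localLayerSubgroupOfEmb κ ι n).subgroupOf (localLayerSubgroupOfEmb κ ι m) with hN
  haveI : Fintype (localLayerSubgroupOfEmb κ ι m ⧸ N) := Fintype.ofFinite _
  rw [mem_localLayerPointsOfEmb_iff]
  intro τ hτ
  rw [localTraceOfEmb_apply, Finset.smul_sum]
  -- reindex along `q ↦ τ • q`
  have key : ∀ q : localLayerSubgroupOfEmb κ ι m ⧸ N,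
      τ • (((q.out : localLayerSubgroupOfEmb κ ι m) : Field.absoluteGaloisGroup E) • P) =
        ((((⟨τ, hτ⟩ : localLayerSubgroupOfEmb κ ι m) • q).out : localLayerSubgroupOfEmb κ ι m) :
          Field.absoluteGaloisGroup E) • P := by
    intro q
    have h1 : (⟨τ, hτ⟩ : localLayerSubgroupOfEmb κ ι m) • q =
        QuotientGroup.mk (s := N) (⟨τ, hτ⟩ * q.out) := by
      conv_lhs => rw [← QuotientGroup.out_eq' q]
      rfl
    rw [h1, out_smul_eq_of_mem κ ι W hP, Subgroup.coe_mul, mul_smul]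
  simp_rw [key]
  exact Fintype.sum_equiv (MulAction.toPerm (⟨τ, hτ⟩ : localLayerSubgroupOfEmb κ ι m)) _ _
    fun q => rfl

/-- On `E(K_m·E)` (points already fixed by the larger group) the trace `Tr_{n/m}` is multiplication
by the index `[Gal(K̄_E/K_m·E) : Gal(K̄_E/K_n·E)]` (`= [K_n·E : K_m·E]` for `m ≤ n`). (API of the transcription of
Def. 1.1.) [cite: Kobayashi2003, Def. 1.1] -/
theorem localTraceOfEmb_apply_of_mem_lower (m n : ℕ) {P : localPoints W E}
    (hP : P ∈ localLayerPointsOfEmb κ ι W m) :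
    localTraceOfEmb κ ι W m n P =
      ((localLayerSubgroupOfEmb κ ι n).subgroupOf (localLayerSubgroupOfEmb κ ι m)).index • P := by
  classical
  set N := (localLayerSubgroupOfEmb κ ι n).subgroupOf (localLayerSubgroupOfEmb κ ι m)
  haveI : Fintype (localLayerSubgroupOfEmb κ ι m ⧸ N) := Fintype.ofFinite _
  rw [localTraceOfEmb_apply]
  have : ∀ q : localLayerSubgroupOfEmb κ ι m ⧸ N,
      (((q.out : localLayerSubgroupOfEmb κ ι m) : Field.absoluteGaloisGroup E)) • P = P :=
    fun q => (mem_localLayerPointsOfEmb_iff κ ι W m P).mp hP _ q.out.2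
  simp_rw [this, Finset.sum_const, Finset.card_univ, Subgroup.index, Nat.card_eq_fintype_card]
  rfl

/-- `Tr_{n/n} P = P` for `P ∈ E(K_n·E)`. (API of the transcription of
Def. 1.1.) [cite: Kobayashi2003, Def. 1.1] -/
theorem localTraceOfEmb_self_of_mem (n : ℕ) {P : localPoints W E}
    (hP : P ∈ localLayerPointsOfEmb κ ι W n) : localTraceOfEmb κ ι W n n P = P := by
  rw [localTraceOfEmb_apply_of_mem_lower κ ι W n n hP, Subgroup.subgroupOf_self, Subgroup.index_top,
    one_smul]

/-! ### Kobayashi's plus/minus subgroups -/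

/-- **Kobayashi's `E^ε(K_n·E)`** (`ε = 1`: `E^+`, even; `ε = -1`: `E^-`, odd), Definition 1.1
verbatim: `E^+(F_{n,p}) = {P ∈ E(F_{n,p}) | Tr_{n/m+1} P ∈ E(F_{m,p}) for even m (0 ≤ m < n)}`,
`E^-(F_{n,p}) = {P ∈ E(F_{n,p}) | Tr_{n/m+1} P ∈ E(F_{m,p}) for odd m (0 ≤ m < n)}`, i.e. the points
`P ∈ E(K_n·E)` with `Tr_{n/m+1} P ∈ E(K_m·E)` for every `m < n` with `(-1)^m = ε`. An additive
subgroup (the trace is additive and `E(K_m·E)` is a subgroup). For `K = ℚ`, `κ` cyclotomic,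
`E = ℚ_p`, `ι = closureEmb`: the groups `E^±(F_{n,p})` of the source ("essentially appeared in
Knospe [8] and Perrin-Riou [13]", p. 2). [cite: Kobayashi2003, Def. 1.1] -/
def signedLocalPointsOfEmb (ε : ℤˣ) (n : ℕ) : AddSubgroup (localPoints W E) where
  carrier := {P | P ∈ localLayerPointsOfEmb κ ι W n ∧ ∀ m < n, (m : ℤ).negOnePow = ε →
    localTraceOfEmb κ ι W (m + 1) n P ∈ localLayerPointsOfEmb κ ι W m}
  zero_mem' := ⟨zero_mem _, fun m _ _ => by rw [map_zero]; exact zero_mem _⟩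
  add_mem' := fun {P Q} hP hQ => ⟨add_mem hP.1 hQ.1, fun m hm hε => by
    rw [map_add]; exact add_mem (hP.2 m hm hε) (hQ.2 m hm hε)⟩
  neg_mem' := fun {P} hP => ⟨neg_mem hP.1, fun m hm hε => by
    rw [map_neg]; exact neg_mem (hP.2 m hm hε)⟩

/-- Membership in `E^ε(K_n·E)` (Definition 1.1 unfolded). [cite: Kobayashi2003, Def. 1.1] -/
theorem mem_signedLocalPointsOfEmb_iff (ε : ℤˣ) (n : ℕ) (P : localPoints W E) :
    P ∈ signedLocalPointsOfEmb κ ι W ε n ↔ P ∈ localLayerPointsOfEmb κ ι W n ∧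
      ∀ m < n, (m : ℤ).negOnePow = ε →
        localTraceOfEmb κ ι W (m + 1) n P ∈ localLayerPointsOfEmb κ ι W m :=
  Iff.rfl

/-- `E^ε(K_n·E) ≤ E(K_n·E)`. [cite: Kobayashi2003, Def. 1.1] -/
theorem signedLocalPointsOfEmb_le (ε : ℤˣ) (n : ℕ) :
    signedLocalPointsOfEmb κ ι W ε n ≤ localLayerPointsOfEmb κ ι W n :=
  fun _ hP => hP.1

/-- The plus condition reads "for every EVEN `m < n`" (`(-1)^m = 1 ↔ m` even): `E^+` verbatim.
[cite: Kobayashi2003, Def. 1.1] -/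
theorem mem_signedLocalPointsOfEmb_one_iff (n : ℕ) (P : localPoints W E) :
    P ∈ signedLocalPointsOfEmb κ ι W 1 n ↔ P ∈ localLayerPointsOfEmb κ ι W n ∧
      ∀ m < n, Even m → localTraceOfEmb κ ι W (m + 1) n P ∈ localLayerPointsOfEmb κ ι W m := by
  simp only [mem_signedLocalPointsOfEmb_iff, Int.negOnePow_eq_one_iff, Int.even_coe_nat]

/-- The minus condition reads "for every ODD `m < n`" (`(-1)^m = -1 ↔ m` odd): `E^-` verbatim.
[cite: Kobayashi2003, Def. 1.1] -/
theorem mem_signedLocalPointsOfEmb_neg_one_iff (n : ℕ) (P : localPoints W E) :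
    P ∈ signedLocalPointsOfEmb κ ι W (-1) n ↔ P ∈ localLayerPointsOfEmb κ ι W n ∧
      ∀ m < n, Odd m → localTraceOfEmb κ ι W (m + 1) n P ∈ localLayerPointsOfEmb κ ι W m := by
  simp only [mem_signedLocalPointsOfEmb_iff, Int.negOnePow_eq_neg_one_iff, Int.odd_coe_nat]

/-- `E^ε(K_0·E) = E(K_0·E) = E(E)`: no condition at the bottom layer (so `E^±(F_{0,p}) = E(ℚ_p)`).
[cite: Kobayashi2003, Def. 1.1] -/
theorem signedLocalPointsOfEmb_zero (ε : ℤˣ) :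
    signedLocalPointsOfEmb κ ι W ε 0 = localLayerPointsOfEmb κ ι W 0 := by
  ext P
  simp [mem_signedLocalPointsOfEmb_iff]

/-- The even condition at `m = 0 < n`: for `n ≥ 1`, `P ∈ E^+(K_n·E)` has `Tr_{n/1} P ∈ E(E)`
(`= E(K_0·E)`; in particular `E^+(F_{1,p}) = {P ∈ E(F_{1,p}) | P ∈ E(ℚ_p)}`, cf.
`localTraceOfEmb_self_of_mem`). [cite: Kobayashi2003, Def. 1.1] -/
theorem localTraceOfEmb_one_mem_of_mem_signedLocalPointsOfEmb_one {n : ℕ} (hn : 0 < n)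
    {P : localPoints W E} (hP : P ∈ signedLocalPointsOfEmb κ ι W 1 n) :
    localTraceOfEmb κ ι W 1 n P ∈ localLayerPointsOfEmb κ ι W 0 :=
  hP.2 0 hn (by rw [Nat.cast_zero, Int.negOnePow_zero])

/-- `E(E) = E(K_0·E) ≤ E^ε(K_n·E)` for every sign and layer: on a point fixed by all of `Γ_E` each
trace `Tr_{n/m+1}` is multiplication by an index (`localTraceOfEmb_apply_of_mem_lower`), which stays
in `E(E) ≤ E(K_m·E)` (so `E(ℚ_p) ⊆ E^+(F_{n,p}) ∩ E^-(F_{n,p})`). (API of the transcription of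
Def. 1.1.) [cite: Kobayashi2003, Def. 1.1] -/
theorem localLayerPointsOfEmb_zero_le_signedLocalPointsOfEmb (ε : ℤˣ) (n : ℕ) :
    localLayerPointsOfEmb κ ι W 0 ≤ signedLocalPointsOfEmb κ ι W ε n := by
  intro P hP
  refine ⟨localLayerPointsOfEmb_mono κ ι W (Nat.zero_le n) hP, fun m _ _ => ?_⟩
  rw [localTraceOfEmb_apply_of_mem_lower κ ι W (m + 1) n
    (localLayerPointsOfEmb_mono κ ι W (Nat.zero_le (m + 1)) hP)]
  exact localLayerPointsOfEmb_mono κ ι W (Nat.zero_le m) (AddSubgroup.nsmul_mem _ hP _)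

/-! ### The chosen embedding -/

variable (E)

/-- `E(K_n·K_v)` for the chosen embedding `closureEmb E` (`E = K_v`). [cite: Kobayashi2003, Def. 1.1] -/
abbrev localLayerPoints (n : ℕ) : AddSubgroup (localPoints W E) :=
  localLayerPointsOfEmb κ (closureEmb (K := K) E) W n

/-- The trace `Tr_{n/m}` for the chosen embedding. [cite: Kobayashi2003, Def. 1.1] -/
abbrev localTrace (m n : ℕ) : localPoints W E →+ localPoints W E :=
  localTraceOfEmb κ (closureEmb (K := K) E) W m n

/-- **Kobayashi's `E^ε(F_{n,v})`** for the chosen embedding (`ε = ±1`). [cite: Kobayashi2003, Def. 1.1] -/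
abbrev signedLocalPoints (ε : ℤˣ) (n : ℕ) : AddSubgroup (localPoints W E) :=
  signedLocalPointsOfEmb κ (closureEmb (K := K) E) W ε n

end Local


/-! ### The Kummer local condition cut out by a subgroup of local points -/

section Kummer

variable {K : Type u} [Field K] (W : WeierstrassCurve K) (p : ℕ)
  (H : Subgroup (Field.absoluteGaloisGroup K))
variable {E : Type u} [Field E] [Algebra K E] (ι : AlgebraicClosure K →ₐ[K] AlgebraicClosure E)

/-- **The Kummer local condition cut out by `A`.** For `H ≤ Γ_K` with fixed field `L`, a
`K`-embedding `ι : K̄ → K̄_E` (the place `w` of `L` above the place of `K` with completion `E`;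
`Gal(K̄_E/L_w) = localSubgroupOfEmb H ι`) and a subgroup `A` of `E(K̄_E)` (meant: of
`E(L_w) = E(K̄_E)^{Gal(K̄_E/L_w)}`): the classes `c ∈ H¹(H, E[p^∞])` whose restriction to
`Gal(K̄_E/L_w)` lies in the image of `A ⊗ ℚ_p/ℤ_p` under the Kummer map
`E(L_w) ⊗ ℚ_p/ℤ_p ↪ H¹(L_w, E[p^∞])` ("We regard `E(K_{n,v}) ⊗ ℚ_p/ℤ_p` as a subgroup of
`H¹(K_{n,v}, E[p^∞])` by the Kummer map", p. 4): concretely, `c = [φ]` for a continuous crossed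
homomorphism `φ` with `ι(φ(τ|_{K̄})) = τ•Q - Q` for all `τ ∈ Gal(K̄_E/L_w)`, where `Q ∈ E(K̄_E)` has
`pᵏ•Q ∈ A` for some `k` (the Kummer cocycle of `pᵏQ ⊗ p⁻ᵏ ∈ A ⊗ ℚ_p/ℤ_p`). An additive subgroup.
[cite: Kobayashi2003, Def. 1.1] -/
def localKummerOverOfEmb (A : AddSubgroup (localPoints W E)) : AddSubgroup (W.subgroupH1 p H) where
  carrier := {c | ∃ (φ : contOneCocycles.{0, u} (discreteTopRep H (W.geomPrimaryTorsion p)))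
      (Q : localPoints W E) (k : ℕ),
      oneCocycleClass (discreteTopRep H (W.geomPrimaryTorsion p)) φ = c ∧ (p ^ k) • Q ∈ A ∧
      ∀ τ : localSubgroupOfEmb H ι,
        pointsMapOfEmb W ι ((φ.1 (resGalSubgroupOfEmb H ι τ) : W.geomPrimaryTorsion p) :
            W.geomPoints) = (τ : Field.absoluteGaloisGroup E) • Q - Q}
  zero_mem' := ⟨0, 0, 0, oneCocycleClass_zero _, by rw [smul_zero]; exact zero_mem A,
    fun τ => by simp⟩
  add_mem' := by
    rintro c₁ c₂ ⟨φ₁, Q₁, k₁, rfl, hA₁, h₁⟩ ⟨φ₂, Q₂, k₂, rfl, hA₂, h₂⟩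
    refine ⟨φ₁ + φ₂, Q₁ + Q₂, k₁ + k₂, (oneCocycleClass_add _ φ₁ φ₂), ?_, fun τ => ?_⟩
    · rw [smul_add]
      refine add_mem ?_ ?_
      · rw [pow_add, mul_nsmul]; exact AddSubgroup.nsmul_mem A hA₁ _
      · rw [pow_add, mul_comm (p ^ k₁) (p ^ k₂), mul_nsmul]; exact AddSubgroup.nsmul_mem A hA₂ _
    · rw [Submodule.coe_add, ContinuousMap.add_apply, AddSubgroup.coe_add, map_add, h₁ τ, h₂ τ,
        smul_add]
      abel
  neg_mem' := by
    rintro c ⟨φ, Q, k, rfl, hA, h⟩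
    refine ⟨-φ, -Q, k, ?_, by rw [smul_neg]; exact neg_mem hA, fun τ => ?_⟩
    · rw [← oneCocycleClassₗ_apply, map_neg, oneCocycleClassₗ_apply]
    · rw [Submodule.coe_neg, ContinuousMap.neg_apply, AddSubgroup.coe_neg, map_neg, h τ, smul_neg]
      abel

variable {W p H ι}

/-- Membership in the Kummer local condition (unfolding). [cite: Kobayashi2003, Def. 1.1] -/
theorem mem_localKummerOverOfEmb_iff (A : AddSubgroup (localPoints W E)) (c : W.subgroupH1 p H) :
    c ∈ localKummerOverOfEmb W p H ι A ↔
      ∃ (φ : contOneCocycles.{0, u} (discreteTopRep H (W.geomPrimaryTorsion p))) (Q : localPoints W E)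
        (k : ℕ), oneCocycleClass (discreteTopRep H (W.geomPrimaryTorsion p)) φ = c ∧
        (p ^ k) • Q ∈ A ∧ ∀ τ : localSubgroupOfEmb H ι,
          pointsMapOfEmb W ι ((φ.1 (resGalSubgroupOfEmb H ι τ) : W.geomPrimaryTorsion p) :
            W.geomPoints) = (τ : Field.absoluteGaloisGroup E) • Q - Q :=
  Iff.rfl

/-- The Kummer condition is monotone in `A`. [cite: Kobayashi2003, Def. 1.1] -/
theorem localKummerOverOfEmb_mono {A B : AddSubgroup (localPoints W E)} (h : A ≤ B) :
    localKummerOverOfEmb W p H ι A ≤ localKummerOverOfEmb W p H ι B := by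
  rintro c ⟨φ, Q, k, hc, hA, hτ⟩
  exact ⟨φ, Q, k, hc, h hA, hτ⟩

/-- **The signed condition refines the classical one**: every class in the Kummer condition cut out
by `A` dies in `H¹(Gal(K̄_E/L_w), E(K̄_E))`, i.e. lies in the tree's local kernel `localKerOverOfEmb`
(its restriction is the class of the principal crossed homomorphism `τ ↦ τQ - Q`; functoriality
`map_oneCocycleClass` and `oneCocycleClass_eq_zero_iff`). Hence `Sel^± ⊆ Sel`.
[cite: Kobayashi2003, Def. 1.1] -/
theorem localKummerOverOfEmb_le_localKerOverOfEmb (A : AddSubgroup (localPoints W E)) :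
    localKummerOverOfEmb W p H ι A ≤ W.localKerOverOfEmb p H ι := by
  rintro c ⟨φ, Q, k, rfl, -, hτ⟩
  change (ContinuousCohomology.map (resGalSubgroupOfEmb H ι) (resHomOfEquivariant _ _ _) 1).hom
      (oneCocycleClass (discreteTopRep H (W.geomPrimaryTorsion p)) φ) = 0
  rw [map_oneCocycleClass, oneCocycleClass_eq_zero_iff]
  exact ⟨Q, fun τ => hτ τ⟩

end Kummer

/-! ### `Sel^±(E/K_n)` and `Sel^±(E/K_∞)` -/

section Selmer

variable {K : Type u} [Field K] [NumberField K] (W : WeierstrassCurve K) {p : ℕ} [Fact p.Prime]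
  (κ : ZpExtension K p)

/-- **Kobayashi's `Sel^ε(E/K_n)`** (`ε = 1`: even/plus, `ε = -1`: odd/minus), Definition 1.1: the
classical Selmer group `Sel_{p^∞}(E/K_n) ⊆ H¹(K_n, E[p^∞])` (`selmerLayer`) cut down, at every place
`v` of `K` above `p` and every place of `K_n` above `v` (all conjugates `conj_σ`, `σ ∈ Γ_K`, of the
condition at the chosen embedding, as in `selmerGroupOver`), to the classes whose local restriction
lies in `E^ε(K_n·K_v) ⊗ ℚ_p/ℤ_p` (Kummer image of `signedLocalPoints`):
`Sel^±(E/F_n) = Ker( Sel(E/F_n) → H¹(F_{n,p}, E[p^∞]) / E^±(F_{n,p}) ⊗ ℚ_p/ℤ_p )`.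
[cite: Kobayashi2003, Def. 1.1] -/
def signedSelmerLayer (ε : ℤˣ) (n : ℕ) : AddSubgroup (W.subgroupH1 p (κ.layerSubgroup n)) :=
  W.selmerLayer κ n ⊓
    ⨅ (v : HeightOneSpectrum (𝓞 K)) (_ : (p : 𝓞 K) ∈ v.asIdeal) (σ : Field.absoluteGaloisGroup K),
      (localKummerOverOfEmb W p (κ.layerSubgroup n) (closureEmb (K := K) (v.adicCompletion K))
          (signedLocalPoints κ (v.adicCompletion K) W ε n)).comap
        (W.conjH1 p (κ.layerSubgroup n) σ)

/-- Membership in `Sel^ε(E/K_n)`. [cite: Kobayashi2003, Def. 1.1] -/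
theorem mem_signedSelmerLayer_iff (ε : ℤˣ) (n : ℕ) (c : W.subgroupH1 p (κ.layerSubgroup n)) :
    c ∈ signedSelmerLayer W κ ε n ↔ c ∈ W.selmerLayer κ n ∧
      ∀ (v : HeightOneSpectrum (𝓞 K)), (p : 𝓞 K) ∈ v.asIdeal → ∀ σ : Field.absoluteGaloisGroup K,
        W.conjH1 p (κ.layerSubgroup n) σ c ∈
          localKummerOverOfEmb W p (κ.layerSubgroup n) (closureEmb (K := K) (v.adicCompletion K))
            (signedLocalPoints κ (v.adicCompletion K) W ε n) := by
  simp only [signedSelmerLayer, AddSubgroup.mem_inf, AddSubgroup.mem_iInf, AddSubgroup.mem_comap]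

/-- `Sel^ε(E/K_n) ≤ Sel_{p^∞}(E/K_n)` ("moderately stronger local conditions at `p`", p. 2).
[cite: Kobayashi2003, Def. 1.1] -/
theorem signedSelmerLayer_le_selmerLayer (ε : ℤˣ) (n : ℕ) :
    signedSelmerLayer W κ ε n ≤ W.selmerLayer κ n :=
  inf_le_left

/-- **Kobayashi's `Sel^ε(E/K_∞) := lim→_n Sel^ε(E/K_n)`**, realised inside
`H¹(K_∞, E[p^∞]) = lim→_n H¹(K_n, E[p^∞])`: the union over `n` of the images of `Sel^ε(E/K_n)` under
the restriction maps `H¹(K_n, E[p^∞]) → H¹(K_∞, E[p^∞])` (`layerToInfty`).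
[cite: Kobayashi2003, Def. 1.1] -/
def signedSelmerInfty (ε : ℤˣ) : AddSubgroup (W.subgroupH1 p κ.kerSubgroup) :=
  ⨆ n : ℕ, (signedSelmerLayer W κ ε n).map (W.layerToInfty κ n)

/-- Each `Sel^ε(E/K_n)` maps into `Sel^ε(E/K_∞)`. [cite: Kobayashi2003, Def. 1.1] -/
theorem map_layerToInfty_signedSelmerLayer_le (ε : ℤˣ) (n : ℕ) :
    (signedSelmerLayer W κ ε n).map (W.layerToInfty κ n) ≤ signedSelmerInfty W κ ε :=
  le_iSup (fun n => (signedSelmerLayer W κ ε n).map (W.layerToInfty κ n)) n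

/-- **`Sel^ε(E/K_∞) ≤ Sel_{p^∞}(E/K_∞)`**: each image of `Sel^ε(E/K_n) ≤ Sel(E/K_n)` lands in
`Sel(E/K_∞)` (the tree's `map_layerToInfty_selmerLayer_le_holds`). [cite: Kobayashi2003, Def. 1.1] -/
theorem signedSelmerInfty_le_selmerInfty (ε : ℤˣ) : signedSelmerInfty W κ ε ≤ W.selmerInfty κ :=
  iSup_le fun n => (AddSubgroup.map_mono (signedSelmerLayer_le_selmerLayer W κ ε n)).trans
    (W.map_layerToInfty_selmerLayer_le_holds κ n)

/-- `Sel^ε(E/K_n)` is stable under the conjugation action of `Γ_K` on `H¹(K_n, E[p^∞])`: the classical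
part by `map_conjH1_selmerGroupOver_le_holds`, the signed conditions because `conj_σ ∘ conj_γ =
conj_{σγ}` permutes them (`conjH1_mul_holds`). [cite: Kobayashi2003, Def. 1.1] -/
theorem conjH1_mem_signedSelmerLayer (ε : ℤˣ) (n : ℕ) (γ : Field.absoluteGaloisGroup K)
    {c : W.subgroupH1 p (κ.layerSubgroup n)} (hc : c ∈ signedSelmerLayer W κ ε n) :
    W.conjH1 p (κ.layerSubgroup n) γ c ∈ signedSelmerLayer W κ ε n := by
  rw [mem_signedSelmerLayer_iff] at hc ⊢
  refine ⟨W.map_conjH1_selmerGroupOver_le_holds p (κ.layerSubgroup n) γ ⟨c, hc.1, rfl⟩,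
    fun v hv σ => ?_⟩
  rw [← AddMonoidHom.comp_apply,
    ← conjH1_mul_holds (κ.layerSubgroup n) (W.geomPrimaryTorsion p) σ γ]
  exact hc.2 v hv (σ * γ)

/-- **`Sel^ε(E/K_∞)` is stable under the conjugation action of `Γ_K`** on `H¹(K_∞, E[p^∞])` — the
action through which `ℤ_p[[Γ]]` "acts naturally on the Pontryagin dual of `Sel^±(E/F_∞)`" (p. 2);
this discharges the field `conj_mem` of `SignedSelmerDualData` below (restriction commutes with
conjugation, `resOfLe_comp_conjH1_holds`). [cite: Kobayashi2003, Def. 1.1] -/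
theorem conjH1_mem_signedSelmerInfty (ε : ℤˣ) (γ : Field.absoluteGaloisGroup K)
    {s : W.subgroupH1 p κ.kerSubgroup} (hs : s ∈ signedSelmerInfty W κ ε) :
    W.conjH1 p κ.kerSubgroup γ s ∈ signedSelmerInfty W κ ε := by
  refine AddSubgroup.iSup_induction (fun n => (signedSelmerLayer W κ ε n).map (W.layerToInfty κ n))
    (C := fun s => W.conjH1 p κ.kerSubgroup γ s ∈ signedSelmerInfty W κ ε) hs ?_ ?_ ?_
  · rintro n s ⟨c, hc, rfl⟩
    refine map_layerToInfty_signedSelmerLayer_le W κ ε n ⟨W.conjH1 p (κ.layerSubgroup n) γ c,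
      conjH1_mem_signedSelmerLayer W κ ε n γ hc, ?_⟩
    change ((W.resOfLe p (κ.kerSubgroup_le_layerSubgroup n)).comp
        (W.conjH1 p (κ.layerSubgroup n) γ)) c = _
    rw [resOfLe_comp_conjH1_holds]
    rfl
  · rw [map_zero]; exact zero_mem _
  · intro s t hs ht; rw [map_add]; exact add_mem hs ht

end Selmer

/-! ### The Pontryagin dual `X^±(E/K_∞)` as a hypothesis structure -/

section Dual

variable {K : Type u} [Field K] [NumberField K] {p : ℕ} [Fact p.Prime]

/-- **Pontryagin-dual data for `Sel^ε(E/K_∞)`** — the signed analogue, field for field, of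
`WeierstrassCurve.SelmerDualData` (file `IwasawaSelmer`): the Iwasawa module
`X^ε(E/K_∞) = Hom(Sel^ε(E/K_∞), ℚ_p/ℤ_p)` ("`ℤ_p[[Γ]]` acts naturally on the Pontryagin dual of
`Sel^±(E/F_∞)`", p. 2) as an abstract `Λ = ℤ_p⟦T⟧`-module `X` with
* `conj_mem`: `Sel^ε_∞` is stable under `conj_γ` (hypothesis field, as in `SelmerDualData`; here
  dischargeable by `conjH1_mem_signedSelmerInfty`);
* `toDual`: a group isomorphism `X ≃ Hom(Sel^ε_∞, ℚ/ℤ)` (`ℚ/ℤ = AddCircle (1 : ℚ) ⊇ ℚ_p/ℤ_p`);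
* `toDual_T_smul`: `T` acts as `γ - 1`; `toDual_C_smul`: constants `c ∈ ℤ_p` act on `pᵏ`-torsion
  classes through `ℤ_p → ℤ/pᵏ`.
Intended with `κ` the cyclotomic `ℤ_p`-extension of `ℚ` and `γ` a topological generator. NOTHING
about existence, uniqueness, finite generation or torsion (Kobayashi Thm. 1.2) is asserted here;
statements consume a datum `D` as a hypothesis. [cite: Kobayashi2003, Def. 1.1 and Thm. 1.2 (the object only)] -/
structure SignedSelmerDualData (W : WeierstrassCurve K) (κ : ZpExtension K p)
    (γ : Field.absoluteGaloisGroup K) (ε : ℤˣ) where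
  /-- The underlying type of the Iwasawa module `X^ε(E/K_∞)`. -/
  X : Type u
  /-- `X` is an abelian group. -/
  [addCommGroup : AddCommGroup X]
  /-- `X` is a `Λ = ℤ_p⟦T⟧`-module. -/
  [module : Module (IwasawaAlgebra p) X]
  /-- `Sel^ε(E/K_∞)` is stable under conjugation by `γ` (hypothesis field; holds by
  `conjH1_mem_signedSelmerInfty`). -/
  conj_mem : ∀ s ∈ signedSelmerInfty W κ ε, W.conjH1 p κ.kerSubgroup γ s ∈ signedSelmerInfty W κ ε
  /-- The identification of `X` with the character group `Hom(Sel^ε_∞, ℚ/ℤ)`. -/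
  toDual : X →+ (signedSelmerInfty W κ ε →+ AddCircle (1 : ℚ))
  /-- `toDual` is a group isomorphism. -/
  bijective : Function.Bijective toDual
  /-- `T` acts as `γ - 1`: `(T·x)(s) = x(conj_γ s) - x(s)`. -/
  toDual_T_smul : ∀ (x : X) (s : signedSelmerInfty W κ ε),
    toDual ((PowerSeries.X : IwasawaAlgebra p) • x) s =
      toDual x ⟨W.conjH1 p κ.kerSubgroup γ s, conj_mem s s.2⟩ - toDual x s
  /-- Constants `c ∈ ℤ_p` act on `pᵏ`-torsion classes through `ℤ_p → ℤ/pᵏ`. -/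
  toDual_C_smul : ∀ (c : ℤ_[p]) (x : X) (s : signedSelmerInfty W κ ε) (k : ℕ), (p ^ k) • s = 0 →
    toDual (PowerSeries.C c • x) s = (PadicInt.toZModPow k c).val • toDual x s

/-- The dual `X^ε` of a datum is an abelian group (the bundled structure, as an instance on the new
type `D.X`; no library instance is touched). [cite: Kobayashi2003, Def. 1.1 and Thm. 1.2 (the object only)] -/
instance SignedSelmerDualData.instAddCommGroupX {W : WeierstrassCurve K} {κ : ZpExtension K p}
    {γ : Field.absoluteGaloisGroup K} {ε : ℤˣ} (D : SignedSelmerDualData W κ γ ε) :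
    AddCommGroup D.X :=
  D.addCommGroup

/-- The dual `X^ε` of a datum is a `Λ`-module (the bundled structure, as an instance on `D.X`).
[cite: Kobayashi2003, Def. 1.1 and Thm. 1.2 (the object only)] -/
instance SignedSelmerDualData.instModuleX {W : WeierstrassCurve K} {κ : ZpExtension K p}
    {γ : Field.absoluteGaloisGroup K} {ε : ℤˣ} (D : SignedSelmerDualData W κ γ ε) :
    Module (IwasawaAlgebra p) D.X :=
  D.module

namespace SignedSelmerDualData

variable {W : WeierstrassCurve K} {κ : ZpExtension K p} {γ : Field.absoluteGaloisGroup K} {ε : ℤˣ}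
  (D : SignedSelmerDualData W κ γ ε)

/-- The **characteristic ideal** `Char(X^ε(E/K_∞)) ⊆ Λ` (`Module.charIdeal`, file `IwasawaAlgebra`);
a generator is a characteristic power series `ξ^ε` of the signed Selmer group — the object of
Kobayashi's main conjecture "`Char(Sel^±(E/F_∞)^∨) = (L_p^±(E, X))`" (p. 2; NOT asserted).
[cite: Kobayashi2003, Def. 1.1 and Thm. 1.2 (the object only)] -/
def charIdeal : Ideal (IwasawaAlgebra p) :=
  Literature.NumberTheory.EllipticCurves.Module.charIdeal (IwasawaAlgebra p) D.X

/-- The **`μ`-invariant** `μ^ε` of `X^ε(E/K_∞)` (`muInvariant`; junk `0` unless `X` is finitely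
generated torsion, as documented in `IwasawaAlgebra`). Kobayashi, Thm. 1.4 ("Let `λ^±` and `μ^±` be
the `λ`- and the `μ`-invariants of `Sel^±(E/F_∞)^∨`"; "The sign in the notation of our `λ`- and
`μ`-invariants are opposite to that of Pollack's", p. 3). [cite: Kobayashi2003, Thm. 1.4 (the invariants only)] -/
def mu : ℕ :=
  muInvariant p D.X

/-- The **`λ`-invariant** `λ^ε` of `X^ε(E/K_∞)` (`lambdaInvariant`; junk `0` unless `X` is finitely
generated torsion). [cite: Kobayashi2003, Thm. 1.4 (the invariants only)] -/
def lambda : ℕ :=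
  lambdaInvariant p D.X

end SignedSelmerDualData

end Dual

end Literature.NumberTheory.EllipticCurves.Kobayashi2003

end
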